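import Literature.Claims.NS.ClayHorizonBridge
import Literature.Analysis.FluidPDE.ClassicalSolutionGalilean
import Literature.Analysis.FluidPDE.PeriodicGalileanNonuniqueness
import HarnessLib

/-!
# Clay (B)/(D) reference — the TORUS-VOCABULARY axis: data and solutions on `𝕋³ = ℝ³/ℤ³`
# (`UnitAddTorus (Fin 3)`, `Torus.IsClassicalNSSolutionOn`) versus Fefferman's periodic fields on `ℝ³`,
# and the zero-mean reduction

Companion to `Literature/Claims/NS/ClayVariants.lean` (the «wrong problem» reference of the D-0090
NS-claims map; Δ1 DOMAIN row «torus-as-quotient vocabulary», Δ4 DATA row «zero average») in the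
namespace `Literature.Claims.NS.ClayVariants`, after `ClayHorizonBridge` (Δ7 horizon). Several
claim skeletons (C20 `Chaabani2020`, C24 `Li2013b`, C02/`Davlatov2020`, C81 `Camlin2025`) type the
claimed periodic theorem over the tree's flat torus `UnitAddTorus (Fin 3)` with data
`Torus.IsSmooth ∧ Torus.IsDivFree (∧ Torus.HasZeroMean)` and solutions `Torus.IsClassicalNSSolutionOn`;
Fefferman's (B)/(D) ((8), (10), (11)) speak of `ℤ³`-periodic smooth fields on `ℝ³`. This file makes
the two vocabularies kernel-equivalent for the UNFORCED problem, so that neither the torus phrasing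
nor a zero-mean normalisation of the datum is by itself a «wrong problem» delta:

* `clayPeriodicErrata_solvable_lift_iff`, `clayPeriodic_solvable_lift_iff` — for a torus datum `U₀`
  and any `ν`: Clay solvability (errata class, resp. printed class (10)) of the Cauchy problem for the
  lifted datum `Torus.lift U₀` ⇔ a classical solution on `𝕋³ × [0, ∞)` with `U 0 = U₀`
  (`torus_descend_of_periodic` / `periodic_lift_of_torus` of `ClayHorizonBridge`, `Torus.lift_injective`,
  and the Δ5 pressure bridge `clayPeriodic_solvable_zero_iff_errata`);
  `clayPeriodic_solvable_lift_iff_forall_Ico` / `_forall_Icc` — the same with torus solutions on every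
  `[0, T)` / `[0, T]` (`ν ≥ 0`; `Torus.IsClassicalNSSolutionOn.exists_Ici_iff_forall_Ico`);
  `clayPeriodic_solvable_zero_iff_torus` — every `ℤ³`-periodic datum is a lift (`Torus.lift_descend`);
* `clayPeriodic_regularityAt_iff_torus`, `…_iff_torus_forall_Ico` — (B) at one `μ > 0` ⇔ «every
  `Torus.IsSmooth`, `Torus.IsDivFree` datum on `𝕋³` has a global (resp. every-finite-horizon)
  classical solution of the unforced system on `𝕋³`»;
* `clayPeriodic_regularityAt_iff_torus_zeroMean`, `…_zeroMean_forall_Ico` — the same with the data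
  restricted to ZERO MEAN (`Torus.HasZeroMean`): the mean `m = ∫ U₀` is removed by the Galilean
  boost `u(t, y) = w(t, y − t m) + m` of the solution issued from `U₀ − m` (tree
  `IsClassicalNSSolutionOn.galileanBoost_const`; on `𝕋³` the volume is `1`, Mathlib `integral_const`);
* `navierStokesExistenceSmoothPeriodic_iff_torus`, `…_iff_torus_zeroMean_forall_Ico` — the leaf (B)
  in torus vocabulary, down to its weakest-looking equivalent form «∀ ν > 0, every smooth
  divergence-free mean-zero datum on `𝕋³` has, for every `T > 0`, a classical solution on `[0, T)`»;
* `navierStokesBreakdownPeriodic_of_not_torusSolvable`, `…_of_not_torusSolvable_Ico` — an UNFORCED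
  torus datum at ONE viscosity with no global (resp. no horizon-`T`) classical solution on `𝕋³`
  proves printed (D).

Usage on a CARD (§3 Clay delta): a torus-typed (B)-claim `∀ U₀, IsSmooth → IsDivFree → (HasZeroMean →)
∀ T > 0, ∃ U P, Torus.IsClassicalNSSolutionOn (Ico 0 T) ν 0 U P ∧ U 0 = U₀` composes to
`clayPeriodic.RegularityAt ν` by `clayPeriodic_regularityAt_iff_torus(_zeroMean)_forall_Ico` and to the
leaf by `clayPeriodic_regularityAt_iff` — no Δ1/Δ4/Δ7 delta; what remains a delta is any further
restriction of the data (Sobolev balls, symmetry, finitely many modes …: Δ4) or a weaker solution notion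
(Δ5).

## References

* C. L. Fefferman, *Existence and smoothness of the Navier–Stokes equation*, CMI 2006, (B), (D),
  (8)–(11) p. 2; errata p. 6. [FeffermanClay2006]
* P. G. Lemarié-Rieusset, *The Navier–Stokes Problem in the 21st Century*, CRC 2016, §1.3,
  eqs. (1.10)–(1.13) (the periodic problem posed on `ℝ³` is the problem on `ℝ³/ℤ³`). [LemarieRieusset2016]
* A. J. Majda, A. L. Bertozzi, *Vorticity and Incompressible Flow*, CUP 2002, §1.2 (Galilean
  invariance), Cor. 3.1. [MajdaBertozziCUP2002]
* T. Tao, Anal. PDE 6 (2013), Lemma 4.1 (ii), §3. [Tao2013Localisation]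

WHAT THIS IS NOT: not a claim about NS regularity or blow-up; not a claim about any author beyond
the typed locator.
-/

noncomputable section

open Set MeasureTheory
open scoped ContDiff

namespace Literature.Claims.NS.ClayVariants

open Literature.Analysis Literature.Analysis.FluidPDE Literature.Analysis.FunctionSpaces

/-! ## Torus data read on `ℝ³` -/

section TorusData

variable {U₀ : UnitAddTorus (Fin 3) → EuclideanSpace ℝ (Fin 3)}

/-- The lift of a smooth torus field is a smooth periodic field on `ℝ³` (this IS the definition of
`Torus.IsSmooth`). [cite: FeffermanClay2006, (8) p. 2] -/
theorem contDiff_lift_iff_isSmooth (U₀ : UnitAddTorus (Fin 3) → EuclideanSpace ℝ (Fin 3)) :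
    ContDiff ℝ ∞ (Torus.lift U₀) ↔ Torus.IsSmooth U₀ :=
  Iff.rfl

/-- Divergence-freeness of a smooth torus field read on the lift (tree `isDivFree_lift_iff`; Fefferman's
`div u = 0`, (2), for periodic fields). [cite: FeffermanClay2006, (2) (8) p. 1–2] -/
theorem isDivFree_lift_iff_torus (hs : Torus.IsSmooth U₀) :
    NSWave0.IsDivFree (Torus.lift U₀) ↔ Torus.IsDivFree U₀ :=
  isDivFree_lift_iff (hs.isContDiff (by simp))

end TorusData

/-! ## Solvability of one Cauchy problem, torus form -/

section Solvable

variable {ν : ℝ}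

/-- **Errata-class Clay solvability for a lifted datum ⇔ a global classical solution on `𝕋³`** (any `ν`,
`f ≡ 0`): descend the `u`,`p`-periodic Clay solution (`torus_descend_of_periodic`), resp. lift the torus
solution (`periodic_lift_of_torus`); the datum matches by `Torus.lift_injective`.
[cite: FeffermanClay2006, (B) with (8) (10) (11) p. 2 and errata p. 6] [cite: LemarieRieusset2016, §1.3 eqs. (1.10)–(1.13)] -/
theorem clayPeriodicErrata_solvable_lift_iff (ν : ℝ) (U₀ : UnitAddTorus (Fin 3) → EuclideanSpace ℝ (Fin 3)) :
    clayPeriodicErrata.Solvable ν 0 (Torus.lift U₀) ↔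
      ∃ (U : ℝ → UnitAddTorus (Fin 3) → EuclideanSpace ℝ (Fin 3)) (P : ℝ → UnitAddTorus (Fin 3) → ℝ),
        Torus.IsClassicalNSSolutionOn (Ici 0) ν 0 U P ∧ U 0 = U₀ := by
  constructor
  · rintro ⟨u, p, hu, hp, hns, hadm⟩
    obtain ⟨hcl, h0⟩ := isNavierStokesSolution_and_smooth_iff.1 ⟨hns, hu, hp⟩
    obtain ⟨hT, hlift⟩ := torus_descend_of_periodic hcl fun t ht => hadm t ht
    refine ⟨_, _, hT, Torus.lift_injective ?_⟩
    rw [hlift 0 (le_refl (0 : ℝ)), h0]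
  · rintro ⟨U, P, hUP, hU0⟩
    obtain ⟨hlift, hper⟩ := periodic_lift_of_torus hUP
    have h0 : (fun t => Torus.lift (U t)) 0 = Torus.lift U₀ := by
      show Torus.lift (U 0) = Torus.lift U₀
      rw [hU0]
    have hns := isNavierStokesSolution_and_smooth_iff.2 ⟨hlift, h0⟩
    exact ⟨_, _, hns.2.1, hns.2.2, hns.1, fun t _ => hper t⟩

/-- **Printed-class (10) Clay solvability for a lifted datum ⇔ a global classical solution on `𝕋³`**
(any `ν`, `f ≡ 0`; through the errata class, `clayPeriodic_solvable_zero_iff_errata`).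
[cite: FeffermanClay2006, (B) with (8) (10) (11) p. 2] [cite: Tao2013Localisation, Lemma 4.1 (ii), §3 eq. (galilean)] -/
theorem clayPeriodic_solvable_lift_iff (ν : ℝ) (U₀ : UnitAddTorus (Fin 3) → EuclideanSpace ℝ (Fin 3)) :
    clayPeriodic.Solvable ν 0 (Torus.lift U₀) ↔
      ∃ (U : ℝ → UnitAddTorus (Fin 3) → EuclideanSpace ℝ (Fin 3)) (P : ℝ → UnitAddTorus (Fin 3) → ℝ),
        Torus.IsClassicalNSSolutionOn (Ici 0) ν 0 U P ∧ U 0 = U₀ := by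
  rw [clayPeriodic_solvable_zero_iff_errata]
  exact clayPeriodicErrata_solvable_lift_iff ν U₀

/-- Printed-class Clay solvability for a lifted datum ⇔ a classical solution on `𝕋³ × [0, T)` for every
`T > 0` (`ν ≥ 0`; patching `Torus.IsClassicalNSSolutionOn.exists_Ici_iff_forall_Ico`).
[cite: FeffermanClay2006, (B) with (8) (10) (11) p. 2] [cite: RobinsonRodrigoSadowskiCUP2016, §8.1] -/
theorem clayPeriodic_solvable_lift_iff_forall_Ico (hν : 0 ≤ ν)
    (U₀ : UnitAddTorus (Fin 3) → EuclideanSpace ℝ (Fin 3)) :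
    clayPeriodic.Solvable ν 0 (Torus.lift U₀) ↔
      ∀ T : ℝ, 0 < T →
        ∃ (U : ℝ → UnitAddTorus (Fin 3) → EuclideanSpace ℝ (Fin 3)) (P : ℝ → UnitAddTorus (Fin 3) → ℝ),
          Torus.IsClassicalNSSolutionOn (Ico 0 T) ν 0 U P ∧ U 0 = U₀ :=
  (clayPeriodic_solvable_lift_iff ν U₀).trans
    (Torus.IsClassicalNSSolutionOn.exists_Ici_iff_forall_Ico hν)

/-- Printed-class Clay solvability for a lifted datum ⇔ a classical solution on `𝕋³ × [0, T]` for every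
`T > 0` (`ν ≥ 0`). [cite: FeffermanClay2006, (B) with (8) (10) (11) p. 2] [cite: RobinsonRodrigoSadowskiCUP2016, §8.1] -/
theorem clayPeriodic_solvable_lift_iff_forall_Icc (hν : 0 ≤ ν)
    (U₀ : UnitAddTorus (Fin 3) → EuclideanSpace ℝ (Fin 3)) :
    clayPeriodic.Solvable ν 0 (Torus.lift U₀) ↔
      ∀ T : ℝ, 0 < T →
        ∃ (U : ℝ → UnitAddTorus (Fin 3) → EuclideanSpace ℝ (Fin 3)) (P : ℝ → UnitAddTorus (Fin 3) → ℝ),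
          Torus.IsClassicalNSSolutionOn (Icc 0 T) ν 0 U P ∧ U 0 = U₀ :=
  (clayPeriodic_solvable_lift_iff ν U₀).trans
    (Torus.IsClassicalNSSolutionOn.exists_Ici_iff_forall_Icc hν)

/-- **Every `ℤ³`-periodic datum is a lift**: printed-class Clay solvability from a periodic `u₀ : ℝ³ → ℝ³`
⇔ a global classical solution on `𝕋³` whose time-`0` slice lifts to `u₀` (`Torus.lift_descend`).
[cite: FeffermanClay2006, (B) with (8) (10) (11) p. 2] -/
theorem clayPeriodic_solvable_zero_iff_torus (ν : ℝ)
    {u₀ : EuclideanSpace ℝ (Fin 3) → EuclideanSpace ℝ (Fin 3)} (hper : IsLatticePeriodic u₀) :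
    clayPeriodic.Solvable ν 0 u₀ ↔
      ∃ (U : ℝ → UnitAddTorus (Fin 3) → EuclideanSpace ℝ (Fin 3)) (P : ℝ → UnitAddTorus (Fin 3) → ℝ),
        Torus.IsClassicalNSSolutionOn (Ici 0) ν 0 U P ∧ Torus.lift (U 0) = u₀ := by
  have hl : Torus.lift (Torus.descend u₀ hper) = u₀ := Torus.lift_descend_holds u₀ hper
  rw [← hl, clayPeriodic_solvable_lift_iff]
  refine exists_congr fun U => exists_congr fun P => and_congr_right fun _ => ?_
  exact ⟨fun h => by rw [h], fun h => Torus.lift_injective h⟩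

end Solvable

/-! ## (B) in torus vocabulary -/

section Regularity

/-- **(B) at one viscosity `μ > 0`, torus form**: `clayPeriodic.RegularityAt μ` ⇔ every smooth
divergence-free datum on `𝕋³` has a classical solution of the unforced system on `𝕋³ × [0, ∞)`.
[cite: FeffermanClay2006, (B) with (8) (10) (11) p. 2] [cite: LemarieRieusset2016, §1.3 eqs. (1.10)–(1.13)] -/
theorem clayPeriodic_regularityAt_iff_torus {μ : ℝ} (hμ : 0 < μ) :
    clayPeriodic.RegularityAt μ ↔
      ∀ U₀ : UnitAddTorus (Fin 3) → EuclideanSpace ℝ (Fin 3), Torus.IsSmooth U₀ → Torus.IsDivFree U₀ →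
        ∃ (U : ℝ → UnitAddTorus (Fin 3) → EuclideanSpace ℝ (Fin 3)) (P : ℝ → UnitAddTorus (Fin 3) → ℝ),
          Torus.IsClassicalNSSolutionOn (Ici 0) μ 0 U P ∧ U 0 = U₀ := by
  have _ := hμ
  constructor
  · intro h U₀ hs hd
    exact (clayPeriodic_solvable_lift_iff μ U₀).1
      (h (Torus.lift U₀) hs ((isDivFree_lift_iff_torus hs).2 hd) (Torus.isLatticePeriodic_lift U₀))
  · intro h u₀ hu₀ hdiv hper
    have hl : Torus.lift (Torus.descend u₀ hper) = u₀ := Torus.lift_descend_holds u₀ hper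
    have hs : Torus.IsSmooth (Torus.descend u₀ hper) := by
      show ContDiff ℝ ∞ (Torus.lift (Torus.descend u₀ hper))
      rw [hl]
      exact hu₀
    have hd : Torus.IsDivFree (Torus.descend u₀ hper) := by
      refine (isDivFree_lift_iff_torus hs).1 ?_
      rw [hl]
      exact hdiv
    have hsol := (clayPeriodic_solvable_lift_iff μ _).2 (h _ hs hd)
    rwa [hl] at hsol

/-- **(B) at one viscosity, torus form with finite horizons**: … ⇔ every smooth divergence-free datum on
`𝕋³` has, for every `T > 0`, a classical solution on `𝕋³ × [0, T)`.
[cite: FeffermanClay2006, (B) with (8) (10) (11) p. 2] [cite: RobinsonRodrigoSadowskiCUP2016, §8.1] -/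
theorem clayPeriodic_regularityAt_iff_torus_forall_Ico {μ : ℝ} (hμ : 0 < μ) :
    clayPeriodic.RegularityAt μ ↔
      ∀ U₀ : UnitAddTorus (Fin 3) → EuclideanSpace ℝ (Fin 3), Torus.IsSmooth U₀ → Torus.IsDivFree U₀ →
        ∀ T : ℝ, 0 < T →
          ∃ (U : ℝ → UnitAddTorus (Fin 3) → EuclideanSpace ℝ (Fin 3)) (P : ℝ → UnitAddTorus (Fin 3) → ℝ),
            Torus.IsClassicalNSSolutionOn (Ico 0 T) μ 0 U P ∧ U 0 = U₀ := by
  rw [clayPeriodic_regularityAt_iff_torus hμ]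
  exact forall₃_congr fun U₀ _ _ => Torus.IsClassicalNSSolutionOn.exists_Ici_iff_forall_Ico hμ.le

/-- Subtracting its mean makes a continuous torus field mean-zero (`𝕋³` has volume `1`).
[cite: FeffermanClay2006, (8) p. 2] -/
theorem hasZeroMean_sub_integral {U₀ : UnitAddTorus (Fin 3) → EuclideanSpace ℝ (Fin 3)}
    (hc : Continuous U₀) : Torus.HasZeroMean fun x => U₀ x - ∫ y, U₀ y := by
  show ∫ x, (U₀ x - ∫ y, U₀ y) = 0
  rw [integral_sub hc.integrable_unitAddTorus (integrable_const _), integral_const]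
  simp

/-- The divergence on `𝕋³` does not see a constant (read on the lift, Mathlib `fderiv_sub_const`).
[cite: FeffermanClay2006, (2) p. 1] -/
theorem torus_isDivFree_sub_const {U₀ : UnitAddTorus (Fin 3) → EuclideanSpace ℝ (Fin 3)}
    (hs : Torus.IsSmooth U₀) (hd : Torus.IsDivFree U₀) (c : EuclideanSpace ℝ (Fin 3)) :
    Torus.IsDivFree fun x => U₀ x - c := by
  have hsl : ContDiff ℝ ∞ (Torus.lift U₀) := hs
  have hs' : Torus.IsSmooth fun x => U₀ x - c := by
    show ContDiff ℝ ∞ fun y => Torus.lift U₀ y - c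
    exact hsl.sub contDiff_const
  refine (isDivFree_lift_iff_torus hs').1 fun x => ?_
  have h := (isDivFree_lift_iff_torus hs).2 hd x
  simp only [NSWave0.divergence] at h ⊢
  have hl : (Torus.lift fun x => U₀ x - c) = fun y => Torus.lift U₀ y - c := rfl
  rwa [hl, fderiv_sub_const]

/-- **(B) at one viscosity, torus form with ZERO-MEAN data**: `clayPeriodic.RegularityAt μ` ⇔ every
smooth divergence-free MEAN-ZERO datum on `𝕋³` has a global classical solution. (⇐): for a general
datum `U₀` with mean `m`, solve from `U₀ − m`, lift to `ℝ³`, and boost by the constant velocity: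
`u(t, y) = w(t, y − t m) + m`, `p(t, y) = q(t, y − t m)` (`IsClassicalNSSolutionOn.galileanBoost_const`),
a velocity-periodic Clay solution from `Torus.lift U₀`. [cite: FeffermanClay2006, (B) with (8) (10) (11) p. 2]
[cite: MajdaBertozziCUP2002, §1.2 (Galilean invariance)] -/
theorem clayPeriodic_regularityAt_iff_torus_zeroMean {μ : ℝ} (hμ : 0 < μ) :
    clayPeriodic.RegularityAt μ ↔
      ∀ U₀ : UnitAddTorus (Fin 3) → EuclideanSpace ℝ (Fin 3), Torus.IsSmooth U₀ → Torus.IsDivFree U₀ →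
        Torus.HasZeroMean U₀ →
          ∃ (U : ℝ → UnitAddTorus (Fin 3) → EuclideanSpace ℝ (Fin 3)) (P : ℝ → UnitAddTorus (Fin 3) → ℝ),
            Torus.IsClassicalNSSolutionOn (Ici 0) μ 0 U P ∧ U 0 = U₀ := by
  rw [clayPeriodic_regularityAt_iff_torus hμ]
  refine ⟨fun h U₀ hs hd _ => h U₀ hs hd, fun h U₀ hs hd => ?_⟩
  -- remove the mean
  set m : EuclideanSpace ℝ (Fin 3) := ∫ y, U₀ y with hm
  have hc : Continuous U₀ := hs.continuous
  have hsl : ContDiff ℝ ∞ (Torus.lift U₀) := hs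
  have hs' : Torus.IsSmooth fun x => U₀ x - m := by
    show ContDiff ℝ ∞ fun y => Torus.lift U₀ y - m
    exact hsl.sub contDiff_const
  obtain ⟨W, Q, hWQ, hW0⟩ :=
    h (fun x => U₀ x - m) hs' (torus_isDivFree_sub_const hs hd m) (hasZeroMean_sub_integral hc)
  -- lift, boost by the constant velocity `-m`, and read the result as a Clay solution from `lift U₀`
  obtain ⟨hlift, hper⟩ := periodic_lift_of_torus hWQ
  have hb := hlift.galileanBoost_const (uniqueDiffOn_Ici 0) (-m)
  have hW0y : ∀ y, Torus.lift (W 0) y = Torus.lift U₀ y - m := fun y => by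
    rw [hW0]
    rfl
  have h0 : (fun t y => Torus.lift (W t) (y + t • (-m)) - -m) 0 = Torus.lift U₀ := by
    funext y
    have h : Torus.lift (W 0) (y + (0 : ℝ) • (-m)) - -m = Torus.lift U₀ y := by
      rw [zero_smul, add_zero, hW0y, sub_neg_eq_add, sub_add_cancel]
    exact h
  obtain ⟨hns, hu, hp⟩ := isNavierStokesSolution_and_smooth_iff.2 ⟨hb, h0⟩
  have hsol : clayPeriodic.Solvable μ 0 (Torus.lift U₀) :=
    ⟨_, _, hu, hp, hns, fun t _ => ((hper t).1.comp_add_right (t • (-m))).sub_const (-m)⟩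
  exact (clayPeriodic_solvable_lift_iff μ U₀).1 hsol

/-- **(B) at one viscosity, torus form, zero-mean data, finite horizons** — the weakest-looking
equivalent phrasing. [cite: FeffermanClay2006, (B) with (8) (10) (11) p. 2] [cite: RobinsonRodrigoSadowskiCUP2016, §8.1] -/
theorem clayPeriodic_regularityAt_iff_torus_zeroMean_forall_Ico {μ : ℝ} (hμ : 0 < μ) :
    clayPeriodic.RegularityAt μ ↔
      ∀ U₀ : UnitAddTorus (Fin 3) → EuclideanSpace ℝ (Fin 3), Torus.IsSmooth U₀ → Torus.IsDivFree U₀ →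
        Torus.HasZeroMean U₀ → ∀ T : ℝ, 0 < T →
          ∃ (U : ℝ → UnitAddTorus (Fin 3) → EuclideanSpace ℝ (Fin 3)) (P : ℝ → UnitAddTorus (Fin 3) → ℝ),
            Torus.IsClassicalNSSolutionOn (Ico 0 T) μ 0 U P ∧ U 0 = U₀ := by
  rw [clayPeriodic_regularityAt_iff_torus_zeroMean hμ]
  exact forall₄_congr fun U₀ _ _ _ => Torus.IsClassicalNSSolutionOn.exists_Ici_iff_forall_Ico hμ.le

/-- **The leaf (B) in torus vocabulary.** [cite: FeffermanClay2006, (B) with (8) (10) (11) p. 2]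
[cite: LemarieRieusset2016, §1.3 eqs. (1.10)–(1.13)] -/
theorem navierStokesExistenceSmoothPeriodic_iff_torus :
    Summit.NavierStokesRegularity.NavierStokesRegularity.NavierStokesExistenceSmoothPeriodic ↔
      ∀ ν : ℝ, 0 < ν →
        ∀ U₀ : UnitAddTorus (Fin 3) → EuclideanSpace ℝ (Fin 3), Torus.IsSmooth U₀ → Torus.IsDivFree U₀ →
          ∃ (U : ℝ → UnitAddTorus (Fin 3) → EuclideanSpace ℝ (Fin 3)) (P : ℝ → UnitAddTorus (Fin 3) → ℝ),
            Torus.IsClassicalNSSolutionOn (Ici 0) ν 0 U P ∧ U 0 = U₀ := by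
  rw [← clayPeriodic_regularity_iff]
  exact forall₂_congr fun ν hν => clayPeriodic_regularityAt_iff_torus hν

/-- **The leaf (B) in its weakest-looking torus form**: ∀ ν > 0, every smooth divergence-free mean-zero
datum on `𝕋³` has, for every `T > 0`, a classical solution of the unforced system on `𝕋³ × [0, T)`.
[cite: FeffermanClay2006, (B) with (8) (10) (11) p. 2] [cite: RobinsonRodrigoSadowskiCUP2016, §8.1] -/
theorem navierStokesExistenceSmoothPeriodic_iff_torus_zeroMean_forall_Ico :
    Summit.NavierStokesRegularity.NavierStokesRegularity.NavierStokesExistenceSmoothPeriodic ↔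
      ∀ ν : ℝ, 0 < ν →
        ∀ U₀ : UnitAddTorus (Fin 3) → EuclideanSpace ℝ (Fin 3), Torus.IsSmooth U₀ → Torus.IsDivFree U₀ →
          Torus.HasZeroMean U₀ → ∀ T : ℝ, 0 < T →
            ∃ (U : ℝ → UnitAddTorus (Fin 3) → EuclideanSpace ℝ (Fin 3)) (P : ℝ → UnitAddTorus (Fin 3) → ℝ),
              Torus.IsClassicalNSSolutionOn (Ico 0 T) ν 0 U P ∧ U 0 = U₀ := by
  rw [← clayPeriodic_regularity_iff]
  exact forall₂_congr fun ν hν => clayPeriodic_regularityAt_iff_torus_zeroMean_forall_Ico hν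

end Regularity

/-! ## (D) from a torus obstruction -/

section Breakdown

/-- **An UNFORCED torus datum at ONE viscosity with no global classical solution on `𝕋³` proves printed
(D)** (`navierStokesBreakdownPeriodic_of_not_regularityAt` after `clayPeriodic_regularityAt_iff_torus`).
[cite: FeffermanClay2006, (D) p. 2] [cite: Tao2013Localisation, Rem. 1.2 footnote] -/
theorem navierStokesBreakdownPeriodic_of_not_torusSolvable {μ : ℝ} (hμ : 0 < μ)
    {U₀ : UnitAddTorus (Fin 3) → EuclideanSpace ℝ (Fin 3)} (hs : Torus.IsSmooth U₀) (hd : Torus.IsDivFree U₀)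
    (hno : ¬ ∃ (U : ℝ → UnitAddTorus (Fin 3) → EuclideanSpace ℝ (Fin 3)) (P : ℝ → UnitAddTorus (Fin 3) → ℝ),
        Torus.IsClassicalNSSolutionOn (Ici 0) μ 0 U P ∧ U 0 = U₀) :
    Summit.NavierStokesRegularity.NavierStokesRegularity.NavierStokesBreakdownPeriodic :=
  navierStokesBreakdownPeriodic_of_not_regularityAt hμ fun h =>
    hno ((clayPeriodic_regularityAt_iff_torus hμ).1 h U₀ hs hd)

/-- **An UNFORCED torus datum at ONE viscosity with no classical solution on some `𝕋³ × [0, T)` proves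
printed (D)** (any `T`; for `T ≤ 0` the hypothesis is never satisfied). [cite: FeffermanClay2006, (D) p. 2] [cite: Tao2013Localisation, Rem. 1.2 footnote] -/
theorem navierStokesBreakdownPeriodic_of_not_torusSolvable_Ico {μ : ℝ} (hμ : 0 < μ)
    {U₀ : UnitAddTorus (Fin 3) → EuclideanSpace ℝ (Fin 3)} (hs : Torus.IsSmooth U₀) (hd : Torus.IsDivFree U₀)
    {T : ℝ}
    (hno : ¬ ∃ (U : ℝ → UnitAddTorus (Fin 3) → EuclideanSpace ℝ (Fin 3)) (P : ℝ → UnitAddTorus (Fin 3) → ℝ),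
        Torus.IsClassicalNSSolutionOn (Ico 0 T) μ 0 U P ∧ U 0 = U₀) :
    Summit.NavierStokesRegularity.NavierStokesRegularity.NavierStokesBreakdownPeriodic :=
  navierStokesBreakdownPeriodic_of_not_torusSolvable hμ hs hd fun ⟨U, P, h, h0⟩ =>
    hno ⟨U, P, h.mono Ico_subset_Ici_self (uniqueDiffOn_Ico 0 T), h0⟩

end Breakdown

end Literature.Claims.NS.ClayVariants

end

-- WHAT THIS IS NOT: not a claim about NS regularity or blow-up; not a claim about any author beyond the typed locator.
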